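import Literature.Probability.Percolation.FivePointBoundaryValues
import HarnessLib

/-!
# The corner toggle: the cross-reference corner law of the five-point observables, for every five-marked discrete domain

Topic `Literature/Probability/Percolation`; lane pcv-sawmu (CriticalPhenomena), door (v-d). At the corner face `y_{a+1}` of a five-marked
discrete domain `D : TriMarkedDomain 5` the two boundary `H_G`-edges — the one dual to `predDart (a+1)` (last dart of the arc `A_a`) and the
one dual to `markDart (a+1)` (first dart of `A_{a+1}`) — carry pattern probabilities related class by class (`cornerToggle_law`):
`H_{a+1,M} ↦ H_{a+1,M}` (same reference; `FivePointBoundaryLaws.lean`), and the CROSS-REFERENCE clauses `H_{a,A} ↦ H_{a+2,A}`,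
`H_{a,B} ↦ H_{a+4,A}`, `H_{a+3,A} ↦ H_{a+2,B}` proved here: by the boundary six-point transport of `FivePointBoundaryValues.lean` a pattern
probability of reference `r ≠ a+1` at such an edge is a single class count `#W_{r,M}(x₁; b) / 2^{#G}` (`patternProb_corner_eq_card_div`),
and the TOGGLE `ξ ↦ (ξ ∖ {b'}) ∪ {b}` of the two sides `b, b'` of the corner face is a bijection `W_{r,M}(x₁; b) ≃ W_{τ(r,M)}(z₁; b')`
(`toggle_mem`, `card_toggle`) with the class relabelling `τ = (toggleIdx, toggleBit)` read off the corner matching (`oldP`, `newP`;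
involutive and pattern-consistent on the six classes allowed by the boundary support rule, `toggle_invol`, `newP_succ`, by `decide`).
The linking bookkeeping uses only the odd-partner uniqueness of `odd_component` in `ξ` and in `ξ ∖ {b'}`.

Provenance: the corner law was found post hoc on the exact tables of the lane's boundary-value cell (MINING-PREREG Am. AI, 125/125 corner
class pairs on five domains) and registered as prediction P-BV5-CORNER (Am. AK: 50/50 + 50/50 on two fresh shapes, three checkers); typed
as (T-CORNER) by b-step0 g10 (c215adec); clause 1 proved in `FivePointBoundaryLaws.lean`, clauses 2–4 here (pcv-sawmu b-engine-2 g7).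

Status in print (lane label cell lit-2 g13 for the corner/site laws): not located in print; nearest printed statement Khristoforov–Smirnov
2021 §2 eq. (4) (p. 5; three-disorder boundary values) [cite: KhristoforovSmirnov2021, §2 eq. (4) (p. 5)]; lane bookkeeping over
Bollobás–Riordan's marked domains [cite: BollobasRiordan2006, Ch. 7 §7.2.2 pp. 168–171]; first stated for every domain and machine-checked here.

## References
* M. Khristoforov, S. Smirnov, *Percolation and O(1) loop model*, arXiv:2111.15612 (2021), §1.2 (Lemma 2, pp. 2–3), §2 (eq. (4), p. 5).
* B. Bollobás, O. Riordan, *Percolation*, Cambridge University Press (2006), Ch. 7 §7.2.2 pp. 168–171.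
-/

/-! # Door (v-d) — part 9: the CORNER TOGGLE — (T-CORNER) cross-reference clauses (b-engine-2 g7)

At the corner face `Y = y_k` the two boundary `H_G`-edges `{Y, x₁}` (across `b = s(v_k, p)`) and `{Y, z₁}` (across `b' = s(v_k, p')`) carry
pattern probabilities related by the toggle `ξ ↦ (ξ ∖ {b'}) ∪ {b}` of six-point configurations: `W_{r,M}(x₁; b) ≃ W_{τ_k(r,M)}(z₁; b')`
with the class relabelling `τ_k` (`toggleIdx`/`toggleBit`): for `k = a+1`, `(a,A) ↦ (a+2,A)`, `(a,B) ↦ (a+4,A)`, `(a+3,A) ↦ (a+2,B)`. -/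

open Finset

namespace Literature.Probability.Percolation.FivePoint

open Literature.Probability.Percolation Literature.Probability.LatticeModels TriMarkedDomain

namespace Bdry

open N5

/-! ### The finite bookkeeping of the toggle (all by `decide`) -/

/-- partner of the corner `y_i` (`i ≠ r`) in the corner matching of the class `(r, M)`: pairs `{r+1, s}` and the third pair, where
`s = r+4` (`M = B`) or `r+2` (`M = A`). [cite: KhristoforovSmirnov2021, §1.2 (loop configurations, pp. 2–4)] -/
def oldP (r : Fin 5) (m : Bool) (i : Fin 5) : Fin 5 :=
  if m then (if i = r + 1 then r + 4 else if i = r + 4 then r + 1 else if i = r + 2 then r + 3 else r + 2)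
  else (if i = r + 1 then r + 2 else if i = r + 2 then r + 1 else if i = r + 3 then r + 4 else r + 3)

/-- the class index after the corner toggle at `y_k`: the old partner of `y_k`. [cite: KhristoforovSmirnov2021, §1.2 (loop configurations, pp. 2–4)] -/
def toggleIdx (k r : Fin 5) (m : Bool) : Fin 5 := oldP r m k

/-- partner in the NEW corner matching after the toggle: pairs `{k, r}` and the old pair not containing `k`. [cite: KhristoforovSmirnov2021, §1.2 (loop configurations, pp. 2–4)] -/
def newP (k r : Fin 5) (m : Bool) (i : Fin 5) : Fin 5 :=
  if i = k then r else if i = r then k else oldP r m i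

/-- the pattern bit after the toggle: `B` iff `y_{q+1}` is paired with `y_{q+4}`. [cite: KhristoforovSmirnov2021, §1.2 (loop configurations, pp. 2–4)] -/
def toggleBit (k r : Fin 5) (m : Bool) : Bool := decide (newP k r m (toggleIdx k r m + 1) = toggleIdx k r m + 4)

/-- the six classes that occur at the two boundary edges of the corner face `y_k`: `(k-1, A/B), (k+2, A)` on the arc `k-1` side and
`(k+1, A/B), (k+3, A)` on the arc `k` side (boundary support). [cite: KhristoforovSmirnov2021, §2 eq. (4) (p. 5)] -/
def Relevant (k r : Fin 5) (m : Bool) : Prop := r = k - 1 ∨ r = k + 1 ∨ (r = k + 2 ∧ m = false) ∨ (r = k + 3 ∧ m = false)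

/-- decidability. [folklore] -/
instance (k r : Fin 5) (m : Bool) : Decidable (Relevant k r m) := by unfold Relevant; infer_instance

/-- the toggle is an involution on the relevant classes. [cite: KhristoforovSmirnov2021, §1.2 (loop configurations, pp. 2–4)] -/
theorem toggle_invol : ∀ (k r : Fin 5) (m : Bool), Relevant k r m →
    toggleIdx k (toggleIdx k r m) (toggleBit k r m) = r ∧ toggleBit k (toggleIdx k r m) (toggleBit k r m) = m := by decide

/-- the toggle preserves relevance. [cite: KhristoforovSmirnov2021, §1.2 (loop configurations, pp. 2–4)] -/
theorem toggle_relevant : ∀ (k r : Fin 5) (m : Bool), Relevant k r m → Relevant k (toggleIdx k r m) (toggleBit k r m) := by decide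

/-- after the toggle `y_{q+1}` is paired with `y_{q+2}` or with `y_{q+4}`. [cite: KhristoforovSmirnov2021, §1.2 (loop configurations, pp. 2–4)] -/
theorem newP_succ : ∀ (k r : Fin 5) (m : Bool), Relevant k r m →
    (newP k r m (toggleIdx k r m + 1) = toggleIdx k r m + 2 ∨ newP k r m (toggleIdx k r m + 1) = toggleIdx k r m + 4) := by decide

/-- relevant classes have `r ≠ k`. [folklore] -/
private theorem relevant_ne : ∀ (k r : Fin 5) (m : Bool), Relevant k r m → r ≠ k := by decide

/-- the old matching is an involution off `r`, without fixed points, avoiding `r`. [folklore] -/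
private theorem oldP_facts : ∀ (r : Fin 5) (m : Bool) (i : Fin 5), i ≠ r →
    oldP r m (oldP r m i) = i ∧ oldP r m i ≠ r ∧ oldP r m i ≠ i := by decide

/-- `y_{r+1}` is paired with `y_s`. [folklore] -/
private theorem oldP_succ : ∀ (r : Fin 5) (m : Bool), oldP r m (r + 1) = (if m then r + 4 else r + 2) := by decide

/-- the third pair: the two corners other than `r`, `r+1`, `s`. [folklore] -/
private theorem oldP_third : ∀ (r : Fin 5) (m : Bool) (i j : Fin 5), (i ≠ r ∧ i ≠ r + 1 ∧ i ≠ oldP r m (r + 1) ∧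
    j ≠ r ∧ j ≠ r + 1 ∧ j ≠ oldP r m (r + 1) ∧ j ≠ i) → j = oldP r m i := by decide

/-- the parity bookkeeping of the toggle, as a propositional fact (mutually exclusive atoms). [folklore] -/
private theorem prop_toggle_parity (a y c z : Prop) (h1 : a → ¬ y) (h2 : a → ¬ c) (h3 : a → ¬ z) (h4 : y → ¬ c) (h5 : y → ¬ z)
    (h6 : z → ¬ c) : (¬ ((¬ ((a ∨ (y ∨ c)) ↔ (y ∨ z))) ↔ (y ∨ a))) ↔ (z ∨ (y ∨ c)) := by
  tauto

/-- `q + 2 ≠ q + 4`. [folklore] -/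
private theorem fin5_add_two_ne_add_four (q : Fin 5) : q + 2 ≠ q + 4 := by revert q; decide

/-- the table at `k = a + 1`. [cite: KhristoforovSmirnov2021, §2 eq. (4) (p. 5)] -/
theorem toggle_table (a : Fin 5) :
    (toggleIdx (a + 1) a false = a + 2 ∧ toggleBit (a + 1) a false = false) ∧
    (toggleIdx (a + 1) a true = a + 4 ∧ toggleBit (a + 1) a true = false) ∧
    (toggleIdx (a + 1) (a + 3) false = a + 2 ∧ toggleBit (a + 1) (a + 3) false = true) ∧
    Relevant (a + 1) a false ∧ Relevant (a + 1) a true ∧ Relevant (a + 1) (a + 3) false := by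
  revert a; decide

/-! ### Small tools -/

/-- the side graph is monotone in the edge set (private copy). [folklore] -/
private theorem sideGraph_mono₉ {A B : Finset (Sym2 (Site 2))} (h : A ⊆ B) : sideGraph A ≤ sideGraph B := by
  rintro F F' ⟨j, hF', hj⟩
  exact ⟨j, hF', h hj⟩


variable {D : TriMarkedDomain 5}

/-- side counts are monotone in the edge set. [folklore] -/
private theorem xiDeg_mono {A B : Finset (Sym2 (Site 2))} (h : A ⊆ B) (F : HexVertex) : xiDeg A F ≤ xiDeg B F := by
  classical
  unfold xiDeg
  exact Finset.card_le_card fun j hj => Finset.mem_filter.2 ⟨Finset.mem_univ _, h (Finset.mem_filter.1 hj).2⟩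

/-- reachability is monotone in the edge set. [folklore] -/
private theorem reach_mono {A B : Finset (Sym2 (Site 2))} (h : A ⊆ B) {F F' : HexVertex} (hr : (sideGraph A).Reachable F F') :
    (sideGraph B).Reachable F F' :=
  hr.mono (sideGraph_mono₉ h)

/-! ### The corner toggle -/

section cornerToggle

variable {k : Fin 5} {Y x₁ z₁ : HexVertex} {p p' : Site 2} (hY : IsCornerFace D k Y)
  (hadj : hexGraph.Adj Y x₁) (he : faceEdge Y x₁ = {D.markSite k, p})
  (hadj' : hexGraph.Adj Y z₁) (he' : faceEdge Y z₁ = {D.markSite k, p'}) (hpp : p ≠ p')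
include hY hadj he hadj' he' hpp

/-- the sides of the corner face lying in `hBonds` are the two bonds `s(v_k, p)`, `s(v_k, p')`. [cite: BollobasRiordan2006, Ch. 7 §7.2.2 pp. 168–171] -/
theorem corner_side_cases {j : Fin 3} (hj : side Y j ∈ hBonds D) :
    side Y j = s(D.markSite k, p) ∨ side Y j = s(D.markSite k, p') := by
  have hu : D.markSite k ∈ D.verts := markSite_mem D k
  obtain ⟨a, c, hac, haG, hadj''⟩ := exists_rep_of_mem_hBonds D hj
  have hinc := inc_side Y j
  rw [hac] at hinc
  obtain ⟨haY, hcY⟩ := inc_mk_iff.1 hinc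
  have hYv : hexFaceVertices Y = {D.markSite k, (D.markDart k).2, (predDart D k).2} := hY
  have hav : a = D.markSite k := by
    rw [hYv] at haY
    simp only [Finset.mem_insert, Finset.mem_singleton] at haY
    rcases haY with h | h | h
    · exact h
    · exact absurd (h ▸ haG) (markDart_snd_not_mem D k)
    · exact absurd (h ▸ haG) (predDart_snd_not_mem D k)
  subst hav
  have hp := cornerEnd_snd_eq_or hadj he hu hY
  have hp' := cornerEnd_snd_eq_or hadj' he' hu hY
  have hc : c = p ∨ c = p' := by
    rw [hYv] at hcY
    simp only [Finset.mem_insert, Finset.mem_singleton] at hcY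
    rcases hcY with h | h | h
    · exact absurd h.symm hadj''.ne
    · rcases hp with hp | hp
      · exact Or.inl (h.trans hp.symm)
      · rcases hp' with hp' | hp'
        · exact Or.inr (h.trans hp'.symm)
        · exact absurd (hp.trans hp'.symm) hpp
    · rcases hp with hp | hp
      · rcases hp' with hp' | hp'
        · exact absurd (hp.trans hp'.symm) hpp
        · exact Or.inr (h.trans hp'.symm)
      · exact Or.inl (h.trans hp.symm)
  rcases hc with rfl | rfl
  · exact Or.inl hac
  · exact Or.inr hac

omit hY hadj' in
/-- the two faces `x₁`, `z₁` are distinct. [cite: BollobasRiordan2006, Ch. 7 §7.2.2 pp. 168–171] -/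
theorem corner_faces_ne : z₁ ≠ x₁ := by
  intro hzx
  obtain ⟨hvp, -⟩ := edge_facts D hadj he (markSite_mem D k)
  have h1 : faceEdge Y x₁ = {D.markSite k, p'} := hzx ▸ he'
  rw [he] at h1
  have : p ∈ ({D.markSite k, p'} : Finset (Site 2)) := by rw [← h1]; simp
  simp only [Finset.mem_insert, Finset.mem_singleton] at this
  rcases this with h | h
  · exact hvp h.symm
  · exact hpp h

open Classical in
/-- **THE CORNER TOGGLE** maps the class `(r, M)` at `x₁` to the class `τ_k(r, M)` at `z₁`: for a relevant class, if
`ξ ∈ W_{r,M}(x₁; s(v_k,p))` then `b' = s(v_k,p') ∈ ξ` and `(ξ ∖ {b'}) ∪ {s(v_k,p)} ∈ W_{τ_k(r,M)}(z₁; b')`. Linking bookkeeping by the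
odd-partner uniqueness of `odd_component` in `ξ` and in `ξ ∖ {b'}` (no path surgery). [cite: KhristoforovSmirnov2021, §1.2 (loop configurations, pp. 2–4)] -/
theorem toggle_mem (r : Fin 5) (m : Bool) (hrel : Relevant k r m) {ξ : Finset (Sym2 (Site 2))}
    (hξ : ξ ∈ (loopSpace6 D (D.markSite k) p x₁).filter fun ξ => InClass D (D.markSite k) p x₁ r m ξ) :
    s(D.markSite k, p') ∈ ξ ∧ s(D.markSite k, p) ∉ ξ ∧
    insert s(D.markSite k, p) (ξ.erase s(D.markSite k, p')) ∈
      (loopSpace6 D (D.markSite k) p' z₁).filter fun ξ =>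
        InClass D (D.markSite k) p' z₁ (toggleIdx k r m) (toggleBit k r m) ξ := by
  classical
  -- names
  set v := D.markSite k with hv
  set b := s(v, p) with hb
  set b' := s(v, p') with hb'def
  have hu : v ∈ D.verts := markSite_mem D k
  have hrk : r ≠ k := relevant_ne k r m hrel
  obtain ⟨hvp, hvY, hpY, hvx, hpx, hYT, hx₁T, hYx₁, hvpadj, hbB⟩ := edge_facts D hadj he hu
  obtain ⟨hvp', -, hp'Y, hvz, hp'z, -, hz₁T, hYz₁, hvp'adj, hb'B⟩ := edge_facts D hadj' he' hu
  have hx₁C : x₁ ∉ corners D := cornerEnd_other_not_corner hadj he hu hY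
  have hz₁C : z₁ ∉ corners D := cornerEnd_other_not_corner hadj' he' hu hY
  have hzx : z₁ ≠ x₁ := corner_faces_ne hadj he he' hpp
  have hbb' : b ≠ b' := by
    intro h
    rw [hb, hb'def, Sym2.eq_iff] at h
    rcases h with ⟨-, h⟩ | ⟨h, -⟩
    · exact hpp h
    · exact hvp' h
  have hYk : Y = yc D k := eq_yc D hY
  have hE₀B : (hBonds D).erase b ⊆ hBonds D := Finset.erase_subset _ _
  -- unpack the class
  rw [c_mem_filter_inClass_iff] at hξ
  obtain ⟨hE, hpar, hreach, hpat⟩ := hξ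
  have hξB : ξ ⊆ hBonds D := hE.trans hE₀B
  have hbξ : b ∉ ξ := fun h => (Finset.mem_erase.1 (hE h)).1 rfl
  have hξ6 : ξ ∈ loopSpace6 D v p x₁ := by
    unfold loopSpace6
    refine Finset.mem_filter.2 ⟨Finset.mem_powerset.2 hE, fun F hF => ?_⟩
    rw [hpar F hF, c_mem_insert_corners_iff]
  have hdeg : ∀ F, xiDeg ξ F ≤ 2 := xiDeg_le_two_of_mem_loopSpace6 D hadj he hu (Or.inr rfl) hξ6
  -- parities in ξ
  have hYodd : Odd (xiDeg ξ Y) := (hpar Y hYT).2 (Finset.mem_insert_of_mem (hYk ▸ yc_mem_corners D k))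
  have hx₁odd : Odd (xiDeg ξ x₁) := (hpar x₁ hx₁T).2 (Finset.mem_insert_self _ _)
  have hcodd : ∀ i, Odd (xiDeg ξ (yc D i)) := fun i => (hpar _ (yc_mem_touching D i)).2 (Finset.mem_insert_of_mem (yc_mem_corners D i))
  have hodd_cases : ∀ F, F ∈ triFacesTouching D.verts → Odd (xiDeg ξ F) → F = x₁ ∨ ∃ i, F = yc D i := by
    intro F hF ho
    have := (hpar F hF).1 ho
    rw [Finset.mem_insert, mem_corners] at this
    exact this
  -- b' ∈ ξ: the only available side of the odd face Y
  have hside : ∀ j, side Y j ∈ ξ → side Y j = b' := by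
    intro j hj
    rcases corner_side_cases hY hadj he hadj' he' hpp (hξB hj) with h | h
    · rw [h] at hj; exact absurd hj hbξ
    · exact h
  have hb'ξ : b' ∈ ξ := by
    have hpos : 0 < xiDeg ξ Y := Nat.pos_of_ne_zero fun h0 => by rw [h0] at hYodd; exact absurd hYodd (by decide)
    unfold xiDeg at hpos
    obtain ⟨j, hj⟩ := Finset.card_pos.1 hpos
    have hj' : side Y j ∈ ξ := (Finset.mem_filter.1 hj).2
    exact hside j hj' ▸ hj'
  refine ⟨hb'ξ, hbξ, ?_⟩
  -- uniqueness of odd partners in ξ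
  have huniq : ∀ {u : HexVertex}, u ∈ triFacesTouching D.verts → Odd (xiDeg ξ u) →
      ∀ Y₂ Y₃, (sideGraph ξ).Reachable u Y₂ → (sideGraph ξ).Reachable u Y₃ → Odd (xiDeg ξ Y₂) → Odd (xiDeg ξ Y₃) →
        Y₂ ≠ u → Y₃ ≠ u → Y₂ = Y₃ := fun huT huo => (odd_component D hξB hdeg huT huo).2
  -- the Y–z₁ adjacency in ξ
  have hYz : (sideGraph ξ).Adj Y z₁ := sideGraph_adj_of_b0_mem D hadj' he' hu hb'ξ
  -- ξ₀ = ξ ∖ {b'}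
  set ξ₀ := ξ.erase b' with hξ₀
  have hξ₀ξ : ξ₀ ⊆ ξ := Finset.erase_subset _ _
  have hξ₀B : ξ₀ ⊆ hBonds D := hξ₀ξ.trans hξB
  have hdeg₀ : ∀ F, xiDeg ξ₀ F ≤ 2 := fun F => (xiDeg_mono hξ₀ξ F).trans (hdeg F)
  have hpar₀ : ∀ F, F ∈ triFacesTouching D.verts →
      (Odd (xiDeg ξ₀ F) ↔ ¬ (F ∈ insert x₁ (corners D) ↔ (F = Y ∨ F = z₁))) := by
    intro F hF
    rw [hξ₀, erase_eq_symmDiff hb'ξ, xorDeg_holds ξ {b'} F, odd_xiDeg_singleton_iff' D hadj' he' hu hF, hpar F hF]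
  -- decoded parities in ξ₀
  have hz₁odd₀ : Odd (xiDeg ξ₀ z₁) := by
    rw [hpar₀ z₁ hz₁T, Finset.mem_insert]
    intro h
    have := h.2 (Or.inr rfl)
    rcases this with h' | h'
    · exact hzx h'
    · exact hz₁C h'
  have hodd₀_of : ∀ {u : HexVertex}, u ∈ triFacesTouching D.verts → Odd (xiDeg ξ u) → u ≠ Y → Odd (xiDeg ξ₀ u) := by
    intro u huT huo huY
    rw [hpar₀ u huT]
    intro h
    have hu' : u ∈ insert x₁ (corners D) := (hpar u huT).1 huo
    rcases h.1 hu' with h' | h'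
    · exact huY h'
    · subst h'
      rcases hodd_cases u huT huo with h'' | ⟨i, h''⟩
      · exact hzx h''
      · exact hz₁C (h'' ▸ yc_mem_corners D i)
  have hodd_of₀ : ∀ {u : HexVertex}, u ∈ triFacesTouching D.verts → Odd (xiDeg ξ₀ u) → u ≠ z₁ → Odd (xiDeg ξ u) ∧ u ≠ Y := by
    intro u huT huo huz
    rw [hpar₀ u huT] at huo
    by_cases huY : u = Y
    · subst huY
      exact absurd (iff_of_true (Finset.mem_insert_of_mem (hYk ▸ yc_mem_corners D k)) (Or.inl rfl)) huo
    · refine ⟨(hpar u huT).2 ?_, huY⟩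
      by_contra hn
      exact huo (iff_of_false hn (fun h => h.elim huY huz))
  -- (L1): the ξ-partner of Y is reached from z₁ in ξ₀
  have L1 : ∀ Z, Z ∈ triFacesTouching D.verts → Odd (xiDeg ξ Z) → Z ≠ Y → (sideGraph ξ).Reachable Y Z →
      (sideGraph ξ₀).Reachable z₁ Z := by
    intro Z hZT hZo hZY hYZ
    obtain ⟨⟨W, hWz, hWo, hzW⟩, -⟩ := odd_component D hξ₀B hdeg₀ hz₁T hz₁odd₀
    have hWT := touching_of_reachable D hξ₀B hz₁T hzW
    obtain ⟨hWoξ, hWY⟩ := hodd_of₀ hWT hWo hWz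
    have hYW : (sideGraph ξ).Reachable Y W := hYz.reachable.trans (reach_mono hξ₀ξ hzW)
    have := huniq hYT hYodd Z W hYZ hYW hZo hWoξ hZY hWY
    rw [this]; exact hzW
  -- (L2): ξ-linked odd faces other than Y stay linked in ξ₀
  have L2 : ∀ u w, u ∈ triFacesTouching D.verts → Odd (xiDeg ξ u) → Odd (xiDeg ξ w) → u ≠ Y → w ≠ Y → u ≠ w →
      (sideGraph ξ).Reachable u w → (sideGraph ξ₀).Reachable u w := by
    intro u w huT huo hwo huY hwY huw huwξ
    obtain ⟨⟨W, hWu, hWo, huW⟩, -⟩ := odd_component D hξ₀B hdeg₀ huT (hodd₀_of huT huo huY)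
    have hWT := touching_of_reachable D hξ₀B huT huW
    by_cases hWz : W = z₁
    · subst hWz
      have huYξ : (sideGraph ξ).Reachable u Y := (reach_mono hξ₀ξ huW).trans hYz.reachable.symm
      have := huniq huT huo w Y huwξ huYξ hwo hYodd (Ne.symm huw) (Ne.symm huY)
      exact absurd this hwY
    · obtain ⟨hWoξ, -⟩ := hodd_of₀ hWT hWo hWz
      have := huniq huT huo w W huwξ (reach_mono hξ₀ξ huW) hwo hWoξ (Ne.symm huw) hWu
      rw [this]; exact huW
  -- old linkings: y_i ~ y_{oldP i} in ξ for i ≠ r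
  have hs : oldP r m (r + 1) = (if m then r + 4 else r + 2) := oldP_succ r m
  have hlink1 : (sideGraph ξ).Reachable (yc D (r + 1)) (yc D (oldP r m (r + 1))) := by
    rw [hs, ← xiLinked_iff_reachable]; exact hpat
  have OLD : ∀ i, i ≠ r → (sideGraph ξ).Reachable (yc D i) (yc D (oldP r m i)) := by
    intro i hir
    by_cases h1 : i = r + 1
    · subst h1; exact hlink1
    by_cases h2 : i = oldP r m (r + 1)
    · rw [h2, (oldP_facts r m (r + 1) (fun e => absurd (add_eq_left.1 e) (by decide))).1]; exact hlink1.symm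
    -- i in the third pair: its odd partner is neither x₁, y_r, y_{r+1}, y_s
    obtain ⟨⟨Z, hZi, hZo, hiZ⟩, -⟩ := odd_component D hξB hdeg (yc_mem_touching D i) (hcodd i)
    have hZT := touching_of_reachable D hξB (yc_mem_touching D i) hiZ
    rcases hodd_cases Z hZT hZo with hZx | ⟨j, hZj⟩
    · -- Z = x₁: then y_i is x₁'s partner y_r
      subst hZx
      have := huniq hx₁T hx₁odd (yc D i) (yc D r) hiZ.symm hreach (hcodd i) (hcodd r)
        (fun e => hx₁C (e ▸ yc_mem_corners D i)) (fun e => hx₁C (e ▸ yc_mem_corners D r))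
      exact absurd (yc_injective D this) hir
    · subst hZj
      have hji : j ≠ i := fun e => hZi (by rw [e])
      have hjr : j ≠ r := by
        rintro rfl
        -- y_i ~ y_r ~ x₁: uniqueness from y_r
        have := huniq (yc_mem_touching D j) (hcodd j) (yc D i) x₁ hiZ.symm hreach.symm (hcodd i) hx₁odd
          (fun e => hir (yc_injective D e)) (fun e => hx₁C (e.symm ▸ yc_mem_corners D j))
        exact hx₁C (this ▸ yc_mem_corners D i)
      have hj1 : j ≠ r + 1 := by
        rintro rfl
        have := huniq (yc_mem_touching D (r + 1)) (hcodd _) (yc D i) (yc D (oldP r m (r + 1))) hiZ.symm hlink1 (hcodd i) (hcodd _)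
          (fun e => h1 (yc_injective D e)) (fun e => (oldP_facts r m (r + 1) (fun e' => absurd (add_eq_left.1 e') (by decide))).2.2 (yc_injective D e))
        exact h2 (yc_injective D this)
      have hjs : j ≠ oldP r m (r + 1) := by
        rintro hjs'
        have hs1 : (sideGraph ξ).Reachable (yc D (oldP r m (r + 1))) (yc D (r + 1)) := hlink1.symm
        rw [← hjs'] at hs1
        have := huniq (yc_mem_touching D j) (hcodd j) (yc D i) (yc D (r + 1)) hiZ.symm hs1 (hcodd i) (hcodd _)
          (fun e => hji.symm (yc_injective D e)) (fun e => hj1 (yc_injective D e).symm)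
        exact h1 (yc_injective D this)
      have := oldP_third r m i j ⟨hir, h1, h2, hjr, hj1, hjs, hji⟩
      rw [← this]; exact hiZ
  -- the class index q and its facts
  have hqk : toggleIdx k r m ≠ k := (oldP_facts r m k hrk.symm).2.2
  -- Φξ
  set Φ := insert b ξ₀ with hΦ
  have hbξ₀ : b ∉ ξ₀ := fun h => hbξ (hξ₀ξ h)
  have hξ₀Φ : ξ₀ ⊆ Φ := Finset.subset_insert _ _
  have hΦE : Φ ⊆ (hBonds D).erase b' := by
    intro e he''
    rcases Finset.mem_insert.1 he'' with rfl | he''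
    · exact Finset.mem_erase.2 ⟨hbb', hbB⟩
    · exact Finset.mem_erase.2 ⟨(Finset.mem_erase.1 he'').1, hξB (hξ₀ξ he'')⟩
  have hparΦ : ParityIs D Φ (insert z₁ (corners D)) := by
    intro F hF
    rw [hΦ, insert_eq_symmDiff hbξ₀, xorDeg_holds ξ₀ {b} F, odd_xiDeg_singleton_iff' D hadj he hu hF, hpar₀ F hF,
      Finset.mem_insert, Finset.mem_insert, mem_corners_iff_or D k, ← hYk]
    refine prop_toggle_parity (F = x₁) (F = Y) (F ∈ cornersNe D k) (F = z₁) (fun ha hy => hYx₁ (hy.symm.trans ha))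
      (fun ha hc => hx₁C (cornersNe_subset_corners D k (ha ▸ hc))) (fun ha hz => hzx (hz.symm.trans ha)) (fun hy hc => ?_)
      (fun hy hz => hYz₁ (hy.symm.trans hz)) (fun hz hc => hz₁C (cornersNe_subset_corners D k (hz ▸ hc)))
    rw [hy, hYk] at hc
    exact yc_not_mem_cornersNe D k hc
  -- the Y–x₁ adjacency in Φ
  have hYx : (sideGraph Φ).Adj Y x₁ := sideGraph_adj_of_b0_mem D hadj he hu (Finset.mem_insert_self _ _)
  -- x₁ ~ y_r in ξ₀
  have hx₁r₀ : (sideGraph ξ₀).Reachable x₁ (yc D r) :=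
    L2 x₁ (yc D r) hx₁T hx₁odd (hcodd r) hYx₁.symm (fun e => hrk (yc_injective D (e.trans hYk)))
      (fun e => hx₁C (e ▸ yc_mem_corners D r)) hreach
  rw [c_mem_filter_inClass_iff]
  refine ⟨hΦE, hparΦ, ?_, ?_⟩
  · -- z₁ ~ y_q
    have h := L1 (yc D (toggleIdx k r m)) (yc_mem_touching D _) (hcodd _) (fun e => hqk (yc_injective D (e.trans hYk)))
      (by rw [hYk]; exact OLD k hrk.symm)
    exact reach_mono hξ₀Φ h
  · -- the pattern: y_{q+1} ~ y_{newP (q+1)}, which is y_{q+2} or y_{q+4}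
    have key : ∀ i, i ≠ toggleIdx k r m → (sideGraph Φ).Reachable (yc D i) (yc D (newP k r m i)) := by
      intro i hiq
      unfold newP
      by_cases hik : i = k
      · rw [if_pos hik, hik, ← hYk]
        exact hYx.reachable.trans (reach_mono hξ₀Φ hx₁r₀)
      rw [if_neg hik]
      by_cases hir : i = r
      · rw [if_pos hir, hir, ← hYk]
        exact (hYx.reachable.trans (reach_mono hξ₀Φ hx₁r₀)).symm
      rw [if_neg hir]
      have hpk : oldP r m i ≠ k := fun e => hiq (by rw [toggleIdx, ← e, (oldP_facts r m i hir).1])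
      refine reach_mono hξ₀Φ (L2 _ _ (yc_mem_touching D i) (hcodd i) (hcodd _) ?_ ?_ ?_ (OLD i hir))
      · exact fun e => hik (yc_injective D (e.trans hYk))
      · exact fun e => hpk (yc_injective D (e.trans hYk))
      · exact fun e => (oldP_facts r m i hir).2.2 (yc_injective D e).symm
    have hq1 : toggleIdx k r m + 1 ≠ toggleIdx k r m := fun e => absurd (add_eq_left.1 e) (by decide)
    have hreach1 := key (toggleIdx k r m + 1) hq1
    unfold patm
    rw [xiLinked_iff_reachable]
    rcases newP_succ k r m hrel with h2 | h4
    · have hbit : toggleBit k r m = false := by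
        unfold toggleBit; rw [decide_eq_false_iff_not, h2]; exact fin5_add_two_ne_add_four _
      rw [hbit]; simp only [Bool.false_eq_true, ↓reduceIte]
      rw [← h2]; exact hreach1
    · have hbit : toggleBit k r m = true := by
        unfold toggleBit; rw [decide_eq_true_iff, h4]
      rw [hbit]; simp only [↓reduceIte]
      rw [← h4]; exact hreach1

open Classical in
/-- **the corner toggle is a bijection of classes**: `#W_{r,M}(x₁; s(v_k,p)) = #W_{τ_k(r,M)}(z₁; s(v_k,p'))` for the six relevant classes.
[cite: KhristoforovSmirnov2021, §1.2 (loop configurations, pp. 2–4)] -/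
theorem card_toggle (r : Fin 5) (m : Bool) (hrel : Relevant k r m) :
    #((loopSpace6 D (D.markSite k) p x₁).filter fun ξ => InClass D (D.markSite k) p x₁ r m ξ) =
      #((loopSpace6 D (D.markSite k) p' z₁).filter fun ξ =>
        InClass D (D.markSite k) p' z₁ (toggleIdx k r m) (toggleBit k r m) ξ) := by
  classical
  have hrel' := toggle_relevant k r m hrel
  obtain ⟨hinv1, hinv2⟩ := toggle_invol k r m hrel
  refine Finset.card_bij' (fun ξ _ => insert s(D.markSite k, p) (ξ.erase s(D.markSite k, p')))
    (fun ζ _ => insert s(D.markSite k, p') (ζ.erase s(D.markSite k, p))) (fun ξ hξ => ?_) (fun ζ hζ => ?_)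
    (fun ξ hξ => ?_) (fun ζ hζ => ?_)
  · exact (toggle_mem hY hadj he hadj' he' hpp r m hrel hξ).2.2
  · have h := (toggle_mem hY hadj' he' hadj he (Ne.symm hpp) _ _ hrel' hζ).2.2
    rw [hinv1, hinv2] at h
    exact h
  · obtain ⟨hb', hb, -⟩ := toggle_mem hY hadj he hadj' he' hpp r m hrel hξ
    have hb2 : s(D.markSite k, p) ∉ ξ.erase s(D.markSite k, p') := fun h => hb (Finset.mem_of_mem_erase h)
    rw [Finset.erase_insert hb2, Finset.insert_erase hb']
  · obtain ⟨hb, hb', -⟩ := toggle_mem hY hadj' he' hadj he (Ne.symm hpp) _ _ hrel' hζ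
    have hb2 : s(D.markSite k, p') ∉ ζ.erase s(D.markSite k, p) := fun h => hb' (Finset.mem_of_mem_erase h)
    rw [Finset.erase_insert hb2, Finset.insert_erase hb]

omit hadj' he' hpp in
open Classical in
/-- at an edge of the corner face `y_k`, a pattern probability of reference `r ≠ k` is the single class count `W_{r,M}` at the other face.
[cite: KhristoforovSmirnov2021, §1.2 (loop configurations, pp. 2–4)] -/
theorem patternProb_corner_eq_card_div {r : Fin 5} (hrk : r ≠ k) (c m : Bool) :
    patternProb D r c m Y x₁ =
      (#((loopSpace6 D (D.markSite k) p x₁).filter fun ξ => InClass D (D.markSite k) p x₁ r m ξ) : ℝ) / 2 ^ #D.verts := by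
  have hu : D.markSite k ∈ D.verts := markSite_mem D k
  have hx₁C : x₁ ∉ corners D := cornerEnd_other_not_corner hadj he hu hY
  rw [ha_patternProb_eq_card_div, ← sixTransport_b D hadj he hu c r m, filter_inClassb_corner_eq_empty hadj he hu hY hrk m,
    Finset.card_empty, zero_add, filter_inClassb_eq_of_not_corner _ _ hx₁C]

/-- **(T-CORNER), CROSS-REFERENCE**: for a relevant class `(r, M)` the pattern probability at the edge `{y_k, x₁}` equals the pattern
probability of the toggled class `τ_k(r, M)` at the edge `{y_k, z₁}`. [cite: KhristoforovSmirnov2021, §2 eq. (4) (p. 5)] -/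
theorem patternProb_corner_toggle (r : Fin 5) (c m : Bool) (hrel : Relevant k r m) :
    patternProb D r c m Y x₁ = patternProb D (toggleIdx k r m) c (toggleBit k r m) Y z₁ := by
  have hrk : r ≠ k := relevant_ne k r m hrel
  have hqk : toggleIdx k r m ≠ k := (oldP_facts r m k hrk.symm).2.2
  rw [patternProb_corner_eq_card_div hY hadj he hrk, patternProb_corner_eq_card_div hY hadj' he' hqk,
    card_toggle hY hadj he hadj' he' hpp r m hrel]

end cornerToggle

/-! ### The corner law in the lane's dart form: the edges dual to `predDart (a+1)` and `markDart (a+1)` -/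

/-- `patternProb` is symmetric in the two faces of the edge. [cite: KhristoforovSmirnov2021, §1.2 (loop configurations, pp. 2–4)] -/
theorem patternProb_comm (r : Fin 5) (c m : Bool) (x x' : HexVertex) : patternProb D r c m x x' = patternProb D r c m x' x := by
  unfold patternProb
  congr 1
  ext σ
  show (if m then MatchB D σ r c else MatchA D σ r c) ∧ (Joined D σ r c x ∨ Joined D σ r c x') ↔
    (if m then MatchB D σ r c else MatchA D σ r c) ∧ (Joined D σ r c x' ∨ Joined D σ r c x)
  rw [or_comm]

/-- anything joined to `y_r` shows that `y_r` is joined to itself (b-step0's `joined_corner_of_joined`, restated).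
[cite: KhristoforovSmirnov2021, §1.2 (loop configurations, pp. 2–4)] -/
private theorem joined_corner_of_joined' {r : Fin 5} {Y : HexVertex} (hY : IsCornerFace D r Y) {σ : SiteConfig (Site 2)} {c : Bool}
    {x : HexVertex} (hJ : Joined D σ r c x) : Joined D σ r c Y := by
  obtain ⟨-, Y', hY', hY'I, -⟩ := hJ
  have e : Y' = Y := cornerFace_unique D hY' hY
  subst e
  exact ⟨hY'I, Y', hY', hY'I, Relation.ReflTransGen.refl⟩

/-- (T-CORNER), same reference (b-step0's `corner_patternProb_eq`, restated for the oriented edges): at any two edges containing `y_r`,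
`H_{r,M}` agree. [cite: KhristoforovSmirnov2021, §1.2 (loop configurations, pp. 2–4)] -/
theorem patternProb_corner_same {r : Fin 5} {Y : HexVertex} (hY : IsCornerFace D r Y) (c m : Bool) (x₁ z₁ : HexVertex) :
    patternProb D r c m Y x₁ = patternProb D r c m Y z₁ := by
  unfold patternProb
  congr 1
  ext σ
  show (if m then MatchB D σ r c else MatchA D σ r c) ∧ (Joined D σ r c Y ∨ Joined D σ r c x₁) ↔
    (if m then MatchB D σ r c else MatchA D σ r c) ∧ (Joined D σ r c Y ∨ Joined D σ r c z₁)
  have h1 : (Joined D σ r c Y ∨ Joined D σ r c x₁) ↔ Joined D σ r c Y := ⟨fun h => h.elim id (joined_corner_of_joined' hY), Or.inl⟩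
  have h2 : (Joined D σ r c Y ∨ Joined D σ r c z₁) ↔ Joined D σ r c Y := ⟨fun h => h.elim id (joined_corner_of_joined' hY), Or.inl⟩
  rw [h1, h2]

/-- the corner face contains both endpoints of each of its two boundary darts, so it is one of the two faces of the dual edge.
[cite: BollobasRiordan2006, Ch. 7 §7.2.2 pp. 168–171] -/
theorem corner_mem_edge {k : Fin 5} {x x' : HexVertex} {w : Site 2} (hadj : hexGraph.Adj x x') (he : faceEdge x x' = {D.markSite k, w})
    (hw : w = (D.markDart k).2 ∨ w = (predDart D k).2) : yc D k = x ∨ yc D k = x' := by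
  have hYv : hexFaceVertices (yc D k) = {D.markSite k, (D.markDart k).2, (predDart D k).2} := yc_spec D k
  refine eq_or_eq_of_inc D hadj he (markSite_mem D k) (yc_mem_touching D k) (inc_mk_iff.2 ⟨?_, ?_⟩)
  · rw [hYv]; simp
  · rw [hYv]; rcases hw with rfl | rfl <;> simp

/-- **(T-CORNER) FOR EVERY FIVE-MARKED DOMAIN — all four clauses of the lane's typed corner law**: across the corner face `y_{a+1}`,
between the `H_G`-edge dual to `predDart (a+1)` (last dart of arc `a`) and the one dual to `markDart (a+1)` (first dart of arc `a+1`):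
`(a+1, M) ↦ (a+1, M)`, `(a, A) ↦ (a+2, A)`, `(a, B) ↦ (a+4, A)`, `(a+3, A) ↦ (a+2, B)`. [cite: KhristoforovSmirnov2021, §2 eq. (4) (p. 5)] -/
theorem cornerToggle_law (a : Fin 5) {x x' z z' : HexVertex} (hx : hexGraph.Adj x x')
    (hex : faceEdge x x' = {(predDart D (a + 1)).1, (predDart D (a + 1)).2}) (hz : hexGraph.Adj z z')
    (hez : faceEdge z z' = {(D.markDart (a + 1)).1, (D.markDart (a + 1)).2}) (c : Bool) :
    (∀ m : Bool, patternProb D (a + 1) c m x x' = patternProb D (a + 1) c m z z') ∧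
      patternProb D a c false x x' = patternProb D (a + 2) c false z z' ∧
      patternProb D a c true x x' = patternProb D (a + 4) c false z z' ∧
      patternProb D (a + 3) c false x x' = patternProb D (a + 2) c true z z' := by
  have hY : IsCornerFace D (a + 1) (yc D (a + 1)) := yc_spec D (a + 1)
  have hpf : (predDart D (a + 1)).1 = D.markSite (a + 1) := predDart_fst D (a + 1)
  have hmf : (D.markDart (a + 1)).1 = D.markSite (a + 1) := rfl
  rw [hpf] at hex
  rw [hmf] at hez
  have hpp : (predDart D (a + 1)).2 ≠ (D.markDart (a + 1)).2 := by
    obtain ⟨w, -, -, -, hor⟩ := isCornerFace_typeII D hY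
    have hne12 : faceVertex (yc D (a + 1)) (w + 1) ≠ faceVertex (yc D (a + 1)) (w + 2) := by
      intro e; exact absurd (add_left_cancel (faceVertex_injective _ e)) (by decide)
    rcases hor with ⟨h1, h2⟩ | ⟨h1, h2⟩
    · rw [← h1, ← h2]; exact hne12
    · rw [← h1, ← h2]; exact hne12.symm
  -- orient both edges with the corner face first
  obtain ⟨x₁, hadj₁, he₁, hxx⟩ : ∃ x₁, hexGraph.Adj (yc D (a + 1)) x₁ ∧
      faceEdge (yc D (a + 1)) x₁ = {D.markSite (a + 1), (predDart D (a + 1)).2} ∧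
      ∀ r c m, patternProb D r c m x x' = patternProb D r c m (yc D (a + 1)) x₁ := by
    rcases corner_mem_edge hx hex (Or.inr rfl) with h | h
    · exact ⟨x', h ▸ hx, h ▸ hex, fun r c m => by rw [h]⟩
    · refine ⟨x, h ▸ hx.symm, by rw [faceEdge_comm, h]; exact hex, fun r c m => by rw [patternProb_comm, h]⟩
  obtain ⟨z₁, hadj₂, he₂, hzz⟩ : ∃ z₁, hexGraph.Adj (yc D (a + 1)) z₁ ∧
      faceEdge (yc D (a + 1)) z₁ = {D.markSite (a + 1), (D.markDart (a + 1)).2} ∧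
      ∀ r c m, patternProb D r c m z z' = patternProb D r c m (yc D (a + 1)) z₁ := by
    rcases corner_mem_edge hz hez (Or.inl rfl) with h | h
    · exact ⟨z', h ▸ hz, h ▸ hez, fun r c m => by rw [h]⟩
    · refine ⟨z, h ▸ hz.symm, by rw [faceEdge_comm, h]; exact hez, fun r c m => by rw [patternProb_comm, h]⟩
  obtain ⟨⟨t1i, t1b⟩, ⟨t2i, t2b⟩, ⟨t3i, t3b⟩, rel1, rel2, rel3⟩ := toggle_table a
  refine ⟨fun m => ?_, ?_, ?_, ?_⟩
  · rw [hxx, hzz]; exact patternProb_corner_same hY c m x₁ z₁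
  · rw [hxx, hzz, patternProb_corner_toggle hY hadj₁ he₁ hadj₂ he₂ hpp a c false rel1, t1i, t1b]
  · rw [hxx, hzz, patternProb_corner_toggle hY hadj₁ he₁ hadj₂ he₂ hpp a c true rel2, t2i, t2b]
  · rw [hxx, hzz, patternProb_corner_toggle hY hadj₁ he₁ hadj₂ he₂ hpp (a + 3) c false rel3, t3i, t3b]

end Bdry

end Literature.Probability.Percolation.FivePoint

/-! # Door (v-d) — part 10: the corner law as a named statement, and the BOUNDARY SIMPLEX (the five allowed pattern probabilities at a
boundary edge of `A_i` sum to one) -/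

open Finset

namespace Literature.Probability.Percolation.FivePoint

open Literature.Probability.Percolation Literature.Probability.LatticeModels TriMarkedDomain

namespace Bdry

open N5

variable (D : TriMarkedDomain 5)

/-- `{x, x'}` is the `H_G`-edge dual to the boundary dart `d`: adjacent faces whose common bond is `{d.1, d.2}`. [cite: BollobasRiordan2006, Ch. 7 §7.2.2 pp. 168–171] -/
def IsDualEdge (d : Site 2 × Site 2) (x x' : HexVertex) : Prop := hexGraph.Adj x x' ∧ faceEdge x x' = {d.1, d.2}

/-- **(T-CORNER) THE CORNER TOGGLE LAW** (statement; the lane's typed target, b-step0 g10 text c215adec): across the corner face `y_{a+1}`,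
between the edge dual to `predDart (a+1)` and the edge dual to `markDart (a+1)`, the five surviving classes are carried into each other:
`(a+1, M) ↦ (a+1, M)`, `(a, A) ↦ (a+2, A)`, `(a, B) ↦ (a+4, A)`, `(a+3, A) ↦ (a+2, B)`. [cite: KhristoforovSmirnov2021, §2 eq. (4) (p. 5)] -/
def CornerToggleLaw (D : TriMarkedDomain 5) : Prop :=
  ∀ (a : Fin 5) (x x' z z' : HexVertex), IsDualEdge (predDart D (a + 1)) x x' → IsDualEdge (D.markDart (a + 1)) z z' →
    ∀ c : Bool,
      (∀ m : Bool, patternProb D (a + 1) c m x x' = patternProb D (a + 1) c m z z') ∧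
      patternProb D a c false x x' = patternProb D (a + 2) c false z z' ∧
      patternProb D a c true x x' = patternProb D (a + 4) c false z z' ∧
      patternProb D (a + 3) c false x x' = patternProb D (a + 2) c true z z'

/-- **(T-CORNER) holds for every five-marked domain.** [cite: KhristoforovSmirnov2021, §2 eq. (4) (p. 5)] -/
theorem cornerToggleLaw_holds : CornerToggleLaw D := by
  intro a x x' z z' hx hz c
  exact cornerToggle_law a hx.1 hx.2 hz.1 hz.2 c

/-! ### The boundary simplex on the arc `A_i` -/

variable {D}

open Classical in
/-- the mid-edge probability splits by the link pattern: `midEdgeProb = H_{r,A} + H_{r,B}`. [cite: KhristoforovSmirnov2021, §1.2 Lemma 2 (pp. 2–3)] -/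
theorem midEdgeProb_eq_patternProb_add (r : Fin 5) (c : Bool) (x x' : HexVertex) :
    midEdgeProb D r c x x' = patternProb D r c false x x' + patternProb D r c true x x' := by
  rw [midEdgeProb_eq_card_div, card_joined_split, ha_patternProb_eq_card_div, ha_patternProb_eq_card_div]
  simp only [Bool.false_eq_true, ↓reduceIte]
  push_cast
  ring

variable (D) in
/-- **THE BOUNDARY SIMPLEX**: at a boundary edge of the arc `A_i` the five allowed pattern probabilities sum to one —
`H_{i,A} + H_{i,B} + H_{i+1,A} + H_{i+1,B} + H_{i+3,A} = 1` (normalisation (N∂) + support (B∂)): the boundary trace of the vector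
`(F_0, …, F_4)` on `A_i` is the image of the standard 4-simplex under a fixed linear map. [cite: KhristoforovSmirnov2021, §2 eq. (4) (p. 5)] -/
theorem boundary_simplex {i : Fin 5} {x x' : HexVertex} (he : IsBoundaryEdge D i x x') (c : Bool) :
    patternProb D i c false x x' + patternProb D i c true x x' + patternProb D (i + 1) c false x x' +
      patternProb D (i + 1) c true x x' + patternProb D (i + 3) c false x x' = 1 := by
  have hN := boundaryNormalisation_holds D i x x' he c
  have hB := boundarySupport_holds D i x x' he
  have hsum : ∑ r : Fin 5, midEdgeProb D r c x x' =
      midEdgeProb D i c x x' + midEdgeProb D (i + 1) c x x' + midEdgeProb D (i + 2) c x x' + midEdgeProb D (i + 3) c x x' +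
        midEdgeProb D (i + 4) c x x' := by
    have hperm : ∀ f : Fin 5 → ℝ, ∑ r : Fin 5, f r = f i + f (i + 1) + f (i + 2) + f (i + 3) + f (i + 4) := by
      intro f
      rw [← Equiv.sum_comp (Equiv.addLeft i) f, Fin.sum_univ_five]
      simp only [Equiv.coe_addLeft, add_zero]
    exact hperm _
  have nA : ∀ j : Fin 5, ¬ AllowedClass j (j + 2) false ∧ ¬ AllowedClass j (j + 2) true ∧ ¬ AllowedClass j (j + 3) true ∧
      ¬ AllowedClass j (j + 4) false ∧ ¬ AllowedClass j (j + 4) true := by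
    unfold AllowedClass; decide
  obtain ⟨n2A, n2B, n3B, n4A, n4B⟩ := nA i
  have z2A : patternProb D (i + 2) c false x x' = 0 := hB (i + 2) c false n2A
  have z2B : patternProb D (i + 2) c true x x' = 0 := hB (i + 2) c true n2B
  have z3B : patternProb D (i + 3) c true x x' = 0 := hB (i + 3) c true n3B
  have z4A : patternProb D (i + 4) c false x x' = 0 := hB (i + 4) c false n4A
  have z4B : patternProb D (i + 4) c true x x' = 0 := hB (i + 4) c true n4B
  rw [hsum] at hN
  simp only [midEdgeProb_eq_patternProb_add, z2A, z2B, z3B, z4A, z4B, add_zero] at hN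
  linarith

end Bdry

end Literature.Probability.Percolation.FivePoint
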